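import Summits.CriticalPhenomena.PercolationContinuityZ3.Theorems.Transplant.TriFilmSKDefs
import Summits.CriticalPhenomena.PercolationContinuityZ3.Theorems.Transplant.Slab111SKBits
import HarnessLib

/-!
# Triangular film `𝕋 × {0,1}`, II: BIT LEMMAS for the triangular-film kernel checker — neighbourhoods, reachability, re-validated paths

builds on p205010 (kernel theorem, internal audit signed; external expert review pending) — NOT used in this file.  Lane `prim-bschramm`, seat
`prim-bschramm-p2` (gen 39; class C1b; memo `HOME/bschramm/P2-LATTICES.md` §138); helper file (`--supports stmt-CriticalPhenomena-4575 --as helper`).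
«Slab111SK4Bits» VERBATIM for the eight-shift neighbourhood `nbhT` of «TriFilmSKDefs» (the layout-free lemmas of «Slab111SKBits» are reused): `AdjRelT`,
`testBit_nbhT` (a set bit has an `AdjRelT`-neighbour in the argument), **`reachT_sound`** (a reachable bit is the end of an `AdjRelT`-walk inside the region),
**`pathOKT_sound`**.  «TriFilmSKGeo» interprets indices as film vertices.
[cite: DuminilCopinSidoraviciusTassion2016, §2.3 (proof of Fact 2)]
-/

namespace Summit.CriticalPhenomena.PercolationContinuityZ3.Theorems.Transplant

namespace TriFilm.SKT

open Slab111.SK (bitOf sdiff maskBelow maskOfList endsOK orFold rd rdMask testBit_bitOf testBit_sdiff)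

/-! ## §1 Masks -/

/-- Index adjacency as a proposition. [folklore] -/
def AdjRelT (i j : ℕ) : Prop :=
  j = i + 1 ∨ j = i + 11 ∨ j = i + 12 ∨ j = i + 144 ∨ i = j + 1 ∨ i = j + 11 ∨ i = j + 12 ∨ i = j + 144

/-- `adjBT` decides `AdjRelT`. [folklore] -/
theorem adjBT_iff {i j : ℕ} : adjBT i j = true ↔ AdjRelT i j := by
  simp only [adjBT, AdjRelT, Bool.or_eq_true, beq_iff_eq, or_assoc]

/-- `AdjRelT` is symmetric. [folklore] -/
theorem AdjRelT.symm {i j : ℕ} (h : AdjRelT i j) : AdjRelT j i := by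
  unfold AdjRelT at *; omega

/-! ## §2 Neighbourhoods and reachability -/

/-- **A bit of the neighbourhood mask has an adjacent bit in the argument** (and lies in the universe). [folklore] -/
theorem testBit_nbhT {u m j : ℕ} (h : (nbhT u m).testBit j = true) : u.testBit j = true ∧ ∃ i, m.testBit i = true ∧ AdjRelT i j := by
  unfold nbhT at h
  rw [Nat.testBit_land, Bool.and_eq_true] at h
  refine ⟨h.2, ?_⟩
  have h1 := h.1
  simp only [Nat.testBit_lor, Bool.or_eq_true, Nat.testBit_shiftLeft, Nat.testBit_shiftRight, Bool.and_eq_true,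
    decide_eq_true_eq] at h1
  unfold AdjRelT
  rcases h1 with ((((((⟨h1, h2⟩ | ⟨h1, h2⟩) | ⟨h1, h2⟩) | ⟨h1, h2⟩) | h2) | h2) | h2) | h2
  · exact ⟨j - 1, h2, by omega⟩
  · exact ⟨j - 11, h2, by omega⟩
  · exact ⟨j - 12, h2, by omega⟩
  · exact ⟨j - 144, h2, by omega⟩
  · exact ⟨1 + j, h2, by omega⟩
  · exact ⟨11 + j, h2, by omega⟩
  · exact ⟨12 + j, h2, by omega⟩
  · exact ⟨144 + j, h2, by omega⟩

/-- **An index walk inside a region**: an `AdjRelT`-chain `s :: l` all of whose members are bits of `R`. [folklore] -/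
def IsWalkInT (R : ℕ) (s : ℕ) (l : List ℕ) : Prop := (s :: l).IsChain AdjRelT ∧ ∀ x ∈ s :: l, R.testBit x = true

/-- The end of the walk `s :: l`. [folklore] -/
def walkEndT (s : ℕ) (l : List ℕ) : ℕ := (s :: l).getLast (List.cons_ne_nil _ _)

/-- Extending a walk by an adjacent region vertex. [folklore] -/
theorem IsWalkInT.snoc {R s : ℕ} {l : List ℕ} (h : IsWalkInT R s l) {j : ℕ} (hadj : AdjRelT (walkEndT s l) j) (hj : R.testBit j = true) :
    IsWalkInT R s (l ++ [j]) ∧ walkEndT s (l ++ [j]) = j := by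
  refine ⟨⟨?_, ?_⟩, ?_⟩
  · have : s :: (l ++ [j]) = (s :: l) ++ [j] := rfl
    rw [this, List.isChain_append]
    refine ⟨h.1, List.IsChain.singleton _, fun x hx y hy => ?_⟩
    rw [List.getLast?_eq_some_getLast (List.cons_ne_nil _ _), Option.mem_def, Option.some.injEq] at hx
    simp only [List.head?_cons, Option.mem_def, Option.some.injEq] at hy
    subst hx hy; exact hadj
  · intro x hx
    simp only [List.mem_cons, List.mem_append, List.not_mem_nil, or_false] at hx
    rcases hx with rfl | hx | rfl
    · exact h.2 _ (by simp)
    · exact h.2 _ (List.mem_cons_of_mem _ hx)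
    · exact hj
  · show ((s :: l) ++ [j]).getLast _ = j
    simp

/-- **SOUNDNESS OF `reachGoT`**: if every bit of `cur` is the end of a walk from a bit of `src` inside `R`, the same holds for the result. [folklore] -/
theorem reachGoT_sound (u R src : ℕ) :
    ∀ (f cur : ℕ), (∀ j, cur.testBit j = true → ∃ s l, src.testBit s = true ∧ IsWalkInT R s l ∧ walkEndT s l = j) →
      ∀ j, (reachGoT u R f cur).testBit j = true → ∃ s l, src.testBit s = true ∧ IsWalkInT R s l ∧ walkEndT s l = j := by
  intro f
  induction f with
  | zero => intro cur hcur j hj; exact hcur j hj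
  | succ f ih =>
    intro cur hcur j hj
    simp only [reachGoT] at hj
    have hnxt : ∀ j, ((cur ||| nbhT u cur) &&& R).testBit j = true → ∃ s l, src.testBit s = true ∧ IsWalkInT R s l ∧ walkEndT s l = j := by
      intro j hj
      rw [Nat.testBit_land, Bool.and_eq_true, Nat.testBit_lor, Bool.or_eq_true] at hj
      rcases hj with ⟨hj | hj, hR⟩
      · exact hcur j hj
      · obtain ⟨-, i, hi, hadj⟩ := testBit_nbhT hj
        obtain ⟨s, l, hs, hw, he⟩ := hcur i hi
        subst he
        exact ⟨s, l ++ [j], hs, (hw.snoc hadj hR).1, (hw.snoc hadj hR).2⟩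
    cases hb : ((cur ||| nbhT u cur) &&& R == cur)
    · rw [hb] at hj; exact ih _ hnxt j hj
    · rw [hb] at hj; exact hcur j hj

/-- **SOUNDNESS OF `reachT`**: a reachable bit is the end of an index walk inside the region from a bit of `src ∩ region`. [folklore] -/
theorem reachT_sound {u R src j : ℕ} (h : (reachT u R src).testBit j = true) :
    ∃ s l, src.testBit s = true ∧ R.testBit s = true ∧ IsWalkInT R s l ∧ walkEndT s l = j := by
  unfold reachT at h
  have base : ∀ j, (src &&& R).testBit j = true → ∃ s l, (src &&& R).testBit s = true ∧ IsWalkInT R s l ∧ walkEndT s l = j := by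
    intro j hj
    refine ⟨j, [], hj, ⟨List.IsChain.singleton _, fun x hx => ?_⟩, rfl⟩
    simp only [List.mem_cons, List.not_mem_nil, or_false] at hx
    subst hx
    rw [Nat.testBit_land, Bool.and_eq_true] at hj
    exact hj.2
  obtain ⟨s, l, hs, hw, he⟩ := reachGoT_sound u R (src &&& R) 300 _ base j h
  rw [Nat.testBit_land, Bool.and_eq_true] at hs
  exact ⟨s, l, hs.1, hs.2, hw, he⟩

/-! ## §3 Re-validated paths -/

/-- **SOUNDNESS OF `pathOKT`**: an `AdjRelT`-chain without repetitions, inside `reg`, off `seen`. [folklore] -/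
theorem pathOKT_sound (reg : ℕ) : ∀ (l : List ℕ) (seen : ℕ), pathOKT reg l seen = true →
    l.IsChain AdjRelT ∧ l.Nodup ∧ ∀ x ∈ l, reg.testBit x = true ∧ seen.testBit x = false
  | [], _, _ => ⟨List.IsChain.nil, List.nodup_nil, fun _ h => nomatch h⟩
  | [i], seen, h => by
    simp only [pathOKT, Bool.and_eq_true, Bool.not_eq_true'] at h
    exact ⟨List.IsChain.singleton _, List.nodup_singleton _, fun x hx => by simp only [List.mem_singleton] at hx; subst hx; exact h⟩
  | i :: j :: rest, seen, h => by
    simp only [pathOKT, Bool.and_eq_true, Bool.not_eq_true'] at h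
    obtain ⟨⟨⟨hi, hsi⟩, hij⟩, hrest⟩ := h
    obtain ⟨hch, hnd, hmem⟩ := pathOKT_sound reg (j :: rest) (seen ||| bitOf i) hrest
    refine ⟨List.isChain_cons_cons.2 ⟨adjBT_iff.1 hij, hch⟩, List.nodup_cons.2 ⟨fun hmi => ?_, hnd⟩, fun x hx => ?_⟩
    · have := (hmem i hmi).2
      rw [Nat.testBit_lor, testBit_bitOf] at this
      simp at this
    · rcases List.mem_cons.1 hx with rfl | hx
      · exact ⟨hi, hsi⟩
      · have := hmem x hx
        rw [Nat.testBit_lor, Bool.or_eq_false_iff] at this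
        exact ⟨this.1, this.2.1⟩

end TriFilm.SKT

end Summit.CriticalPhenomena.PercolationContinuityZ3.Theorems.Transplant
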